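import Summits.AtomisticToContinuum.Crystallization.Theorems.ExcessDecayLiouvilleScaleArithEnergy

/-!
# Route `ExcessDecayLiouville`: scaling form of the named currencies (square sum, masses, gradient currency, brackets)

Harmonic-replacement architecture for item `ExcessDecay` (stmt-AtomisticToContinuum-9334), nonlinear half.
Pure real-variable inequalities bounding the named currencies of `ExcessDecayLiouvilleScaleDefs` by monomials in the
scale `ρ`, the mass constant `C`, the matching radius `r`, the crude bound `Du`, the forcing floor `Φ = phiOf Du r δ`
and the global gradient bound `N`, with every numerical constant absorbed into powers of the level constant
`L = lcOf κ ≥ 2.39·10⁸` (`1/κ ≤ L`).  This file: `W`, `M_sh`, `J_v`, `P_Y` in monomial form and the two brackets of `Θ₁, Θ₂`.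
All `[folklore]`; helper lemmas, nothing here closes an item.
-/

noncomputable section

namespace Summit.AtomisticToContinuum.Crystallization.Theorems.ExcessDecayLiouville

-- the constants of the quintic bound
local notation "𝔎q₁" => (2 * (((64 * 2 * (131072 * (38 * 4 ^ 5 * (1024 / (23 / 25 : ℝ) ^ 3))) + 64 * 120 ^ 5 * 327680 +
        4 * (1245184 * 4096)) + (64 * 2 * (3200000 * (1024 / (23 / 25 : ℝ) ^ 3) * 72704) + 4 * (32768 * 256))) * 23146))
local notation "𝔎q₂" => (2 * (4 * (32768 * 8192 * (343 / 512) * 16384 / 4 + 1245184 * 8192 * (343 / 512) * 16384)) * (23146 : ℝ) ^ 2)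
local notation "𝔎q₃" => (2 * (4 * (32768 * (32 * (8 / 3 : ℝ) ^ 8))) * (23146 : ℝ) ^ 3)
local notation "𝔎q₄" => (2 * (2 ^ (5 + 1) * (2 * (19 * 16 * (1024 / ((23 / 25 : ℝ) ^ 3 * (23 / 25 : ℝ) ^ 3))) +
        16 * (11 / 10 : ℝ) ^ 8 * (1024 / ((23 / 25 : ℝ) ^ 3 * (23 / 25 : ℝ) ^ 3))) * (32 * 4 ^ 6)) * (23146 : ℝ) ^ 4)
local notation "𝔎q₅" => (2048 * (1178 / 189 : ℝ) ^ 2 * (23146 : ℝ) ^ 5)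

/-! ## Stage-2 arithmetic, part 5: `W`, `M_sh`, `J_v`, `P_Y` in monomial form -/

/-- Nonnegativity of the correction energy bound. [folklore] -/
theorem ewOf_nonneg (κ ρ C r δ Du Dv j b : ℝ) : 0 ≤ ewOf κ ρ C r δ Du Dv j b := by
  unfold ewOf; positivity

/-- **The square sum of the correction in monomial form**:
`W ≤ L¹² (C + Λ² C ρ⁶ + ρ⁷ Φ² + ρ⁴ Du²/r⁴)`. [folklore] -/
theorem wsqOf_le {κ ρ C r δ Du j b : ℝ} (hκ : 0 < κ) (hκ1 : κ ≤ 1) (hρ : 64 ≤ ρ) (hρr : ρ ≤ r) (hC : 0 ≤ C) (hr : 1 ≤ r)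
    (hDu : 0 ≤ Du) (hj : 0 ≤ j) (hb : 0 ≤ b) (hΛ1 : lamOf Du j b ≤ 1) :
    wsqOf κ ρ C r δ Du Du j b ≤ lcOf κ ^ 12 *
      (C + lamOf Du j b ^ 2 * C * ρ ^ 6 + ρ ^ 7 * phiOf Du r δ ^ 2 + ρ ^ 4 * Du ^ 2 / r ^ 4) := by
  have hρ0 : 0 < ρ := by linarith
  have hr0 : 0 < r := by linarith
  obtain ⟨hL, -, -⟩ := lcOf_ge hκ hκ1
  have hL0 : 0 ≤ lcOf κ := le_trans (by norm_num) hL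
  have hE := ewOf_le (δ := δ) hκ hκ1 hρ hρr hC hr hDu hj hb hΛ1
  have hE0 : 0 ≤ ewOf κ ρ C r δ Du Du j b := ewOf_nonneg _ _ _ _ _ _ _ _ _
  have hω0 : 0 ≤ 400 * rhoP ρ / 189 + 2 := by have := rhoP_pos hρ; positivity
  have hω := omega_le hρ
  have hS0 : 0 ≤ C / ρ ^ 2 + lamOf Du j b ^ 2 * C * ρ ^ 4 + ρ ^ 5 * phiOf Du r δ ^ 2 + ρ ^ 2 * Du ^ 2 / r ^ 4 := by
    positivity
  have h48 : (48922 : ℝ) ^ 2 ≤ lcOf κ ^ 2 := pow_le_pow_left₀ (by norm_num) (le_trans (by norm_num) hL) 2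
  unfold wsqOf
  calc (400 * rhoP ρ / 189 + 2) ^ 2 * ewOf κ ρ C r δ Du Du j b
      ≤ (48922 * ρ) ^ 2 * (lcOf κ ^ 10 *
          (C / ρ ^ 2 + lamOf Du j b ^ 2 * C * ρ ^ 4 + ρ ^ 5 * phiOf Du r δ ^ 2 + ρ ^ 2 * Du ^ 2 / r ^ 4)) :=
        mul_le_mul (pow_le_pow_left₀ hω0 hω 2) hE hE0 (by positivity)
    _ = 48922 ^ 2 * (lcOf κ ^ 10 * (ρ ^ 2 *
          (C / ρ ^ 2 + lamOf Du j b ^ 2 * C * ρ ^ 4 + ρ ^ 5 * phiOf Du r δ ^ 2 + ρ ^ 2 * Du ^ 2 / r ^ 4))) := by ring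
    _ ≤ lcOf κ ^ 2 * (lcOf κ ^ 10 * (ρ ^ 2 *
          (C / ρ ^ 2 + lamOf Du j b ^ 2 * C * ρ ^ 4 + ρ ^ 5 * phiOf Du r δ ^ 2 + ρ ^ 2 * Du ^ 2 / r ^ 4))) :=
        mul_le_mul_of_nonneg_right h48 (by positivity)
    _ = lcOf κ ^ 12 * (C + lamOf Du j b ^ 2 * C * ρ ^ 6 + ρ ^ 7 * phiOf Du r δ ^ 2 + ρ ^ 4 * Du ^ 2 / r ^ 4) := by
        field_simp

/-- **The sharp mass constant in monomial form**: `M_sh ≤ L⁴ C ρ⁶`. [folklore] -/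
theorem mshOf_le {κ C ρ : ℝ} (hκ : 0 < κ) (hκ1 : κ ≤ 1) (hρ : 64 ≤ ρ) (hC : 0 ≤ C) :
    mshOf C ρ ≤ lcOf κ ^ 4 * (C * ρ ^ 6) := by
  have hρ0 : 0 < ρ := by linarith
  obtain ⟨hL, -, -⟩ := lcOf_ge hκ hκ1
  have hP0 : 0 < rhoP ρ := rhoP_pos hρ
  have hP : 4 * rhoP ρ + 4 ≤ 92464 * ρ := by have := rhoP_le hρ; linarith
  have h6 : (4 * rhoP ρ + 4) ^ 6 ≤ (92464 * ρ) ^ 6 := pow_le_pow_left₀ (by positivity) hP 6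
  have hN : (32 : ℝ) * 92464 ^ 6 ≤ 239000000 ^ 4 := by norm_num
  have hL4 : (239000000 : ℝ) ^ 4 ≤ lcOf κ ^ 4 := pow_le_pow_left₀ (by norm_num) hL 4
  unfold mshOf
  calc 32 * C * (4 * rhoP ρ + 4) ^ 6 ≤ 32 * C * (92464 * ρ) ^ 6 := mul_le_mul_of_nonneg_left h6 (by positivity)
    _ = (32 * 92464 ^ 6) * (C * ρ ^ 6) := by ring
    _ ≤ lcOf κ ^ 4 * (C * ρ ^ 6) := mul_le_mul_of_nonneg_right (hN.trans hL4) (by positivity)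

/-- The far-mass bound at a floor `Y ≥ Y₀ > 0`: `J_v(Y) ≤ 4096 C/Y₀² + 89915392 Dv²/(r⁴ Y₀)`. [folklore] -/
theorem jvOf_le {C r Dv Y Y₀ : ℝ} (hC : 0 ≤ C) (hr : 0 < r) (hY₀ : 0 < Y₀) (hY : Y₀ ≤ Y) :
    jvOf C r Dv Y ≤ 4096 * C / Y₀ ^ 2 + 89915392 * Dv ^ 2 / (r ^ 4 * Y₀) := by
  have hY0 : 0 < Y := lt_of_lt_of_le hY₀ hY
  unfold jvOf
  have e : 8192 * (7 * r / 8) ^ 3 * Dv ^ 2 / ((r / 4) ^ 7 * Y) = 89915392 * Dv ^ 2 / (r ^ 4 * Y) := by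
    field_simp
    ring
  rw [e]
  gcongr

/-- The dyadic gradient currency is the quintic at `4Y` over `Y⁸` plus the global term. [folklore] -/
theorem pyOf_eq (κ ρ C r δ Du Dv j b Ntot : ℝ) :
    pyOf κ ρ C r δ Du Dv j b Ntot =
      2 * quinticOf κ C r δ Du Dv j b (4 * yOf ρ) / yOf ρ ^ 8 + 256 * Ntot / ((r / 64) ^ 7 * yOf ρ) := by
  unfold pyOf quinticOf
  ring

/-- **The dyadic gradient currency in monomial form** (`Dv = Du`):
`P_Y ≤ L⁴ (C/ρ⁴ + Du²/(r⁴ρ⁵) + Φ²/ρ³ + N_tot/(r⁷ρ))`. [folklore] -/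
theorem pyOf_le {κ ρ C r δ Du j b Ntot : ℝ} (hκ : 0 < κ) (hκ1 : κ ≤ 1) (hρ : 64 ≤ ρ) (hC : 0 ≤ C) (hr : 1 ≤ r)
    (hDu : 0 ≤ Du) (hj : 0 ≤ j) (hb : 0 ≤ b) (hΛ1 : lamOf Du j b ≤ 1) (hN : 0 ≤ Ntot) :
    pyOf κ ρ C r δ Du Du j b Ntot ≤ lcOf κ ^ 4 *
      (C / ρ ^ 4 + Du ^ 2 / (r ^ 4 * ρ ^ 5) + phiOf Du r δ ^ 2 / ρ ^ 3 + Ntot / (r ^ 7 * ρ)) := by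
  have hρ0 : 0 < ρ := by linarith
  have hρ1 : (1 : ℝ) ≤ ρ := by linarith
  have hr0 : 0 < r := by linarith
  obtain ⟨hL, hLκ, -⟩ := lcOf_ge hκ hκ1
  have hL0 : 0 ≤ lcOf κ := le_trans (by norm_num) hL
  have hL1 : 1 ≤ lcOf κ := le_trans (by norm_num) hL
  have hYge : 90 * ρ ≤ yOf ρ := yOf_ge ρ
  have hYle : yOf ρ ≤ 91 * ρ := yOf_le hρ
  have hY0 : 0 < yOf ρ := by linarith
  rw [pyOf_eq]
  -- the quintic at 4Y
  have hx : 4 * yOf ρ ≤ 23146 * ρ := by linarith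
  have hq := quinticOf_le (δ := δ) (Dv := Du) hκ hκ1 hC hr0 hDu hj hb hΛ1 hρ (by positivity) hx
  have hq0 : 0 ≤ quinticOf κ C r δ Du Du j b (4 * yOf ρ) := quinticOf_nonneg' hκ hC hr0 hDu hj hb (by positivity)
  set Φ := phiOf Du r δ with hΦ
  -- monomials
  set mC : ℝ := C / ρ ^ 4 with hmC
  set mU : ℝ := Du ^ 2 / (r ^ 4 * ρ ^ 5) with hmU
  set mΦ : ℝ := Φ ^ 2 / ρ ^ 3 with hmΦ
  set mN : ℝ := Ntot / (r ^ 7 * ρ) with hmN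
  have hmC0 : 0 ≤ mC := by positivity
  have hmU0 : 0 ≤ mU := by positivity
  have hmΦ0 : 0 ≤ mΦ := by positivity
  have hmN0 : 0 ≤ mN := by positivity
  have hK1 : (0 : ℝ) ≤ 𝔎q₁ := by positivity
  have hK2 : (0 : ℝ) ≤ 𝔎q₂ := by positivity
  have hK3 : (0 : ℝ) ≤ 𝔎q₃ := by positivity
  have hK4 : (0 : ℝ) ≤ 𝔎q₄ := by positivity
  have hK5 : (0 : ℝ) ≤ 𝔎q₅ := by positivity
  -- (1) the quintic part over Y⁸ ≥ (90ρ)⁸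
  have hY8 : (90 * ρ) ^ 8 ≤ yOf ρ ^ 8 := pow_le_pow_left₀ (by positivity) hYge 8
  have hA : 2 * quinticOf κ C r δ Du Du j b (4 * yOf ρ) / yOf ρ ^ 8 ≤
      2 * (1 / κ ^ 2 * (𝔎q₁ * (C * ρ) + 𝔎q₂ * (Du ^ 2 * ρ ^ 2 / r ^ 4) + 𝔎q₃ * (Du ^ 2 * ρ ^ 3 / r ^ 5) +
        𝔎q₄ * (C * ρ ^ 4) + 𝔎q₅ * (Φ ^ 2 * ρ ^ 5))) / (90 * ρ) ^ 8 := by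
    refine div_le_div₀ (by positivity) (by linarith only [hq]) (by positivity) hY8
  -- conversions of the bracket monomials over ρ⁸
  have c1 : C * ρ / ρ ^ 8 ≤ mC := by
    rw [hmC, div_le_div_iff₀ (by positivity) (by positivity)]
    have h : ρ ^ 5 ≤ ρ ^ 8 := pow_le_pow_right₀ hρ1 (by norm_num)
    nlinarith only [h, hC, hρ0]
  have c2 : Du ^ 2 * ρ ^ 2 / r ^ 4 / ρ ^ 8 ≤ mU := by
    rw [hmU, div_div, div_le_div_iff₀ (by positivity) (by positivity)]
    have h : ρ ^ 7 ≤ ρ ^ 8 := pow_le_pow_right₀ hρ1 (by norm_num)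
    have h0 : 0 ≤ Du ^ 2 * r ^ 4 := by positivity
    nlinarith only [h, h0]
  have c3 : Du ^ 2 * ρ ^ 3 / r ^ 5 / ρ ^ 8 ≤ mU := by
    rw [hmU, div_div, div_le_div_iff₀ (by positivity) (by positivity)]
    have h : r ^ 4 ≤ r ^ 5 := pow_le_pow_right₀ hr (by norm_num)
    have h0 : 0 ≤ Du ^ 2 * ρ ^ 8 := by positivity
    nlinarith only [h, h0]
  have c4 : C * ρ ^ 4 / ρ ^ 8 = mC := by
    rw [hmC]; field_simp
  have c5 : Φ ^ 2 * ρ ^ 5 / ρ ^ 8 = mΦ := by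
    rw [hmΦ]; field_simp
  have hA' : 2 * (1 / κ ^ 2 * (𝔎q₁ * (C * ρ) + 𝔎q₂ * (Du ^ 2 * ρ ^ 2 / r ^ 4) + 𝔎q₃ * (Du ^ 2 * ρ ^ 3 / r ^ 5) +
        𝔎q₄ * (C * ρ ^ 4) + 𝔎q₅ * (Φ ^ 2 * ρ ^ 5))) / (90 * ρ) ^ 8 ≤
      (1 / κ ^ 2) * (2 / 90 ^ 8) * ((𝔎q₁ + 𝔎q₄) * mC + (𝔎q₂ + 𝔎q₃) * mU + 𝔎q₅ * mΦ) := by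
    have e : 2 * (1 / κ ^ 2 * (𝔎q₁ * (C * ρ) + 𝔎q₂ * (Du ^ 2 * ρ ^ 2 / r ^ 4) + 𝔎q₃ * (Du ^ 2 * ρ ^ 3 / r ^ 5) +
        𝔎q₄ * (C * ρ ^ 4) + 𝔎q₅ * (Φ ^ 2 * ρ ^ 5))) / (90 * ρ) ^ 8 =
        (1 / κ ^ 2) * (2 / 90 ^ 8) * (𝔎q₁ * (C * ρ / ρ ^ 8) + 𝔎q₂ * (Du ^ 2 * ρ ^ 2 / r ^ 4 / ρ ^ 8) +
          𝔎q₃ * (Du ^ 2 * ρ ^ 3 / r ^ 5 / ρ ^ 8) + 𝔎q₄ * (C * ρ ^ 4 / ρ ^ 8) + 𝔎q₅ * (Φ ^ 2 * ρ ^ 5 / ρ ^ 8)) := by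
      field_simp
    rw [e]
    have hik : 0 ≤ (1 / κ ^ 2) * (2 / 90 ^ 8 : ℝ) := by positivity
    refine mul_le_mul_of_nonneg_left ?_ hik
    nlinarith only [mul_le_mul_of_nonneg_left c1 hK1, mul_le_mul_of_nonneg_left c2 hK2, mul_le_mul_of_nonneg_left c3 hK3,
      c4, c5, hK4, hK5]
  -- (2) the global term
  have hB : 256 * Ntot / ((r / 64) ^ 7 * yOf ρ) ≤ (256 * 64 ^ 7 / 90) * mN := by
    rw [hmN]
    have e : (256 * 64 ^ 7 / 90 : ℝ) * (Ntot / (r ^ 7 * ρ)) = 256 * Ntot / ((r / 64) ^ 7 * (90 * ρ)) := by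
      field_simp
    rw [e]
    gcongr
  -- (3) constants against powers of L
  have hN1 : (2 / 90 ^ 8 : ℝ) * (𝔎q₁ + 𝔎q₄) ≤ 239000000 ^ 2 := by norm_num
  have hN2 : (2 / 90 ^ 8 : ℝ) * (𝔎q₂ + 𝔎q₃) ≤ 239000000 ^ 2 := by norm_num
  have hN3 : (2 / 90 ^ 8 : ℝ) * 𝔎q₅ ≤ 239000000 ^ 2 := by norm_num
  have hN4 : (256 * 64 ^ 7 / 90 : ℝ) ≤ 239000000 ^ 2 := by norm_num
  have hL2 : (239000000 : ℝ) ^ 2 ≤ lcOf κ ^ 2 := pow_le_pow_left₀ (by norm_num) hL 2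
  have hk2 : 1 / κ ^ 2 ≤ lcOf κ ^ 2 := by
    rw [show 1 / κ ^ 2 = (1 / κ) ^ 2 by rw [div_pow, one_pow]]
    exact pow_le_pow_left₀ (by positivity) hLκ 2
  have hik : 0 ≤ 1 / κ ^ 2 := by positivity
  have hsum : (1 / κ ^ 2) * (2 / 90 ^ 8) * ((𝔎q₁ + 𝔎q₄) * mC + (𝔎q₂ + 𝔎q₃) * mU + 𝔎q₅ * mΦ) + (256 * 64 ^ 7 / 90) * mN ≤
      lcOf κ ^ 2 * lcOf κ ^ 2 * (mC + mU + mΦ) + lcOf κ ^ 2 * mN := by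
    have h1 : (2 / 90 ^ 8) * ((𝔎q₁ + 𝔎q₄) * mC + (𝔎q₂ + 𝔎q₃) * mU + 𝔎q₅ * mΦ) ≤ lcOf κ ^ 2 * (mC + mU + mΦ) := by
      nlinarith only [hN1, hN2, hN3, hL2, hmC0, hmU0, hmΦ0]
    have h2 : (1 / κ ^ 2) * ((2 / 90 ^ 8) * ((𝔎q₁ + 𝔎q₄) * mC + (𝔎q₂ + 𝔎q₃) * mU + 𝔎q₅ * mΦ)) ≤
        lcOf κ ^ 2 * (lcOf κ ^ 2 * (mC + mU + mΦ)) :=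
      mul_le_mul hk2 h1 (by positivity) (by positivity)
    have h3 : (256 * 64 ^ 7 / 90) * mN ≤ lcOf κ ^ 2 * mN := mul_le_mul_of_nonneg_right (hN4.trans hL2) hmN0
    nlinarith only [h2, h3]
  have hL2' : lcOf κ ^ 2 ≤ lcOf κ ^ 4 := pow_le_pow_right₀ hL1 (by norm_num)
  calc _ ≤ (1 / κ ^ 2) * (2 / 90 ^ 8) * ((𝔎q₁ + 𝔎q₄) * mC + (𝔎q₂ + 𝔎q₃) * mU + 𝔎q₅ * mΦ) + (256 * 64 ^ 7 / 90) * mN :=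
        add_le_add (hA.trans hA') hB
    _ ≤ lcOf κ ^ 2 * lcOf κ ^ 2 * (mC + mU + mΦ) + lcOf κ ^ 2 * mN := hsum
    _ ≤ lcOf κ ^ 4 * (mC + mU + mΦ) + lcOf κ ^ 4 * mN := by
        have e : lcOf κ ^ 2 * lcOf κ ^ 2 = lcOf κ ^ 4 := by ring
        rw [e]
        nlinarith only [hL2', hmN0]
    _ = lcOf κ ^ 4 * (mC + mU + mΦ + mN) := by ring

/-! ## Stage-2 arithmetic, part 6: `Θ₁`, `Θ₂`, `V²`, `J` in monomial form -/

/-- The first bracket of `Θ₁, Θ₂` (sharp mass, square sum, far mass at the floor `Y ≥ 90ρ`):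
`L(2M + 2W)/(11520ρ + 2388)² + 2J_v + 2Y⁻⁸W ≤ ρ³ L¹³ (Cρ + ρ²Φ² + Du²/(ρ r⁴))`. [folklore] -/
theorem bracket_one_le {L ρ r C Du Λ Φ M W Jv Y : ℝ} (hL : 239000000 ≤ L) (hρ : 64 ≤ ρ) (hr : 1 ≤ r) (hC : 0 ≤ C)
    (hΛ0 : 0 ≤ Λ) (hΛ1 : Λ ≤ 1) (hM : M ≤ L ^ 4 * (C * ρ ^ 6)) (hW0 : 0 ≤ W)
    (hW : W ≤ L ^ 12 * (C + Λ ^ 2 * C * ρ ^ 6 + ρ ^ 7 * Φ ^ 2 + ρ ^ 4 * Du ^ 2 / r ^ 4))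
    (hJv : Jv ≤ 4096 * C / (90 * ρ) ^ 2 + 89915392 * Du ^ 2 / (r ^ 4 * (90 * ρ))) (hY0 : 0 < Y) (hY : 90 * ρ ≤ Y) :
    L * ((2 * M + 2 * W) / (1280 * (9 * ρ) + 2388) ^ 2 + (2 * Jv + 2 * Y⁻¹ ^ 8 * W)) ≤
      ρ ^ 3 * L ^ 13 * (C * ρ + ρ ^ 2 * Φ ^ 2 + Du ^ 2 / (ρ * r ^ 4)) := by
  have hρ0 : 0 < ρ := by linarith
  have hρ1 : (1 : ℝ) ≤ ρ := by linarith
  have hr0 : 0 < r := by linarith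
  have hL0 : 0 ≤ L := le_trans (by norm_num) hL
  have hL1 : 1 ≤ L := le_trans (by norm_num) hL
  set S₃ : ℝ := C * ρ + ρ ^ 2 * Φ ^ 2 + Du ^ 2 / (ρ * r ^ 4) with hS₃
  have hm1 : 0 ≤ C * ρ := by positivity
  have hm2 : 0 ≤ ρ ^ 2 * Φ ^ 2 := by positivity
  have hm3 : 0 ≤ Du ^ 2 / (ρ * r ^ 4) := by positivity
  have hS0 : 0 ≤ S₃ := by positivity
  have hΛ2 : Λ ^ 2 ≤ 1 := pow_le_one₀ hΛ0 hΛ1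
  -- S_W ≤ 2 ρ⁵ S₃ and M ≤ L⁴ ρ⁵ S₃
  have hρ6 : (1 : ℝ) ≤ ρ ^ 6 := one_le_pow₀ hρ1
  have hSW : C + Λ ^ 2 * C * ρ ^ 6 + ρ ^ 7 * Φ ^ 2 + ρ ^ 4 * Du ^ 2 / r ^ 4 ≤ 2 * ρ ^ 5 * S₃ := by
    have e : 2 * ρ ^ 5 * S₃ = 2 * (C * ρ ^ 6) + 2 * (ρ ^ 7 * Φ ^ 2) + 2 * (ρ ^ 4 * Du ^ 2 / r ^ 4) := by
      rw [hS₃]; field_simp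
    rw [e]
    have h1 : C ≤ C * ρ ^ 6 := by nlinarith only [hC, hρ6]
    have h2 : Λ ^ 2 * C * ρ ^ 6 ≤ C * ρ ^ 6 := by
      have : 0 ≤ C * ρ ^ 6 := by positivity
      nlinarith only [hΛ2, this]
    have h3 : 0 ≤ ρ ^ 7 * Φ ^ 2 := by positivity
    have h4 : 0 ≤ ρ ^ 4 * Du ^ 2 / r ^ 4 := by positivity
    linarith
  have hMW : 2 * M + 2 * W ≤ 6 * L ^ 12 * ρ ^ 5 * S₃ := by
    have hL4 : L ^ 4 ≤ L ^ 12 := pow_le_pow_right₀ hL1 (by norm_num)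
    have h1 : M ≤ L ^ 12 * ρ ^ 5 * S₃ := by
      calc M ≤ L ^ 4 * (C * ρ ^ 6) := hM
        _ ≤ L ^ 4 * (ρ ^ 5 * S₃) := by
            refine mul_le_mul_of_nonneg_left ?_ (by positivity)
            rw [hS₃]; nlinarith only [hm2, hm3, pow_nonneg hρ0.le 5]
        _ ≤ L ^ 12 * (ρ ^ 5 * S₃) := mul_le_mul_of_nonneg_right hL4 (by positivity)
        _ = L ^ 12 * ρ ^ 5 * S₃ := by ring
    have h2 : W ≤ 2 * (L ^ 12 * ρ ^ 5 * S₃) := by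
      calc W ≤ L ^ 12 * (C + Λ ^ 2 * C * ρ ^ 6 + ρ ^ 7 * Φ ^ 2 + ρ ^ 4 * Du ^ 2 / r ^ 4) := hW
        _ ≤ L ^ 12 * (2 * ρ ^ 5 * S₃) := mul_le_mul_of_nonneg_left hSW (by positivity)
        _ = 2 * (L ^ 12 * ρ ^ 5 * S₃) := by ring
    linarith
  -- (1) the sharp-mass / square-sum term
  have hden : (11520 * ρ) ^ 2 ≤ (1280 * (9 * ρ) + 2388) ^ 2 :=
    pow_le_pow_left₀ (by positivity) (by linarith) 2
  have t1 : L * ((2 * M + 2 * W) / (1280 * (9 * ρ) + 2388) ^ 2) ≤ (6 / 11520 ^ 2) * L ^ 13 * ρ ^ 3 * S₃ := by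
    have h1 : (2 * M + 2 * W) / (1280 * (9 * ρ) + 2388) ^ 2 ≤ (6 * L ^ 12 * ρ ^ 5 * S₃) / (11520 * ρ) ^ 2 :=
      div_le_div₀ (by positivity) hMW (by positivity) hden
    have e : (6 * L ^ 12 * ρ ^ 5 * S₃) / (11520 * ρ) ^ 2 = (6 / 11520 ^ 2) * L ^ 12 * ρ ^ 3 * S₃ := by
      field_simp
    rw [e] at h1
    calc L * ((2 * M + 2 * W) / (1280 * (9 * ρ) + 2388) ^ 2) ≤ L * ((6 / 11520 ^ 2) * L ^ 12 * ρ ^ 3 * S₃) :=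
          mul_le_mul_of_nonneg_left h1 hL0
      _ = _ := by ring
  -- (2) the far mass
  have hX0 : 0 ≤ ρ ^ 3 * S₃ := by positivity
  have t2 : 2 * Jv ≤ 2000000 * ρ ^ 3 * S₃ := by
    have h1 : 4096 * C / (90 * ρ) ^ 2 ≤ 2 * (ρ ^ 3 * S₃) := by
      have e : 4096 * C / (90 * ρ) ^ 2 = (4096 / 8100) * ((C * ρ) / ρ ^ 3) := by field_simp; norm_num
      rw [e]
      have h : (C * ρ) / ρ ^ 3 ≤ ρ ^ 3 * S₃ := by
        rw [div_le_iff₀ (by positivity)]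
        have h6 : C * ρ ≤ C * ρ * ρ ^ 6 := by nlinarith only [hm1, hρ6]
        have h7 : C * ρ ≤ S₃ := by rw [hS₃]; linarith
        calc C * ρ ≤ C * ρ * ρ ^ 6 := h6
          _ ≤ S₃ * ρ ^ 6 := mul_le_mul_of_nonneg_right h7 (by positivity)
          _ = ρ ^ 3 * S₃ * ρ ^ 3 := by ring
      have h0 : 0 ≤ (C * ρ) / ρ ^ 3 := by positivity
      nlinarith only [h, h0]
    have h2 : 89915392 * Du ^ 2 / (r ^ 4 * (90 * ρ)) ≤ 999060 * (ρ ^ 3 * S₃) := by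
      have e : 89915392 * Du ^ 2 / (r ^ 4 * (90 * ρ)) = (89915392 / 90) * (Du ^ 2 / (ρ * r ^ 4)) := by field_simp
      rw [e]
      have hρ3 : (1 : ℝ) ≤ ρ ^ 3 := one_le_pow₀ hρ1
      have h : Du ^ 2 / (ρ * r ^ 4) ≤ ρ ^ 3 * S₃ := by
        have h7 : Du ^ 2 / (ρ * r ^ 4) ≤ S₃ := by rw [hS₃]; linarith
        nlinarith only [h7, hρ3, hm3, hS0]
      nlinarith only [h, hm3]
    nlinarith only [h1, h2, hJv, hX0]
  -- (3) the floor-weighted square sum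
  have hYinv : Y⁻¹ ^ 8 ≤ (90 * ρ)⁻¹ ^ 8 := pow_le_pow_left₀ (by positivity) (inv_anti₀ (by positivity) hY) 8
  have t3 : 2 * Y⁻¹ ^ 8 * W ≤ (4 / 90 ^ 8) * L ^ 12 * ρ ^ 3 * S₃ := by
    have h1 : 2 * Y⁻¹ ^ 8 * W ≤ 2 * (90 * ρ)⁻¹ ^ 8 * W := by
      have := mul_le_mul_of_nonneg_right hYinv hW0
      linarith
    have h2 : 2 * (90 * ρ)⁻¹ ^ 8 * W ≤ 2 * (90 * ρ)⁻¹ ^ 8 * (2 * (L ^ 12 * ρ ^ 5 * S₃)) := by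
      refine mul_le_mul_of_nonneg_left ?_ (by positivity)
      have := mul_le_mul_of_nonneg_left hSW (pow_nonneg hL0 12)
      linarith
    have e : 2 * (90 * ρ)⁻¹ ^ 8 * (2 * (L ^ 12 * ρ ^ 5 * S₃)) = (4 / 90 ^ 8) * L ^ 12 * (S₃ / ρ ^ 3) := by
      field_simp; ring
    have h3 : S₃ / ρ ^ 3 ≤ ρ ^ 3 * S₃ := by
      rw [div_le_iff₀ (by positivity)]
      have hρ6' : (1 : ℝ) ≤ ρ ^ 3 * ρ ^ 3 := one_le_mul_of_one_le_of_one_le (one_le_pow₀ hρ1) (one_le_pow₀ hρ1)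
      nlinarith only [hS0, hρ6']
    calc 2 * Y⁻¹ ^ 8 * W ≤ 2 * (90 * ρ)⁻¹ ^ 8 * (2 * (L ^ 12 * ρ ^ 5 * S₃)) := h1.trans h2
      _ = (4 / 90 ^ 8) * L ^ 12 * (S₃ / ρ ^ 3) := e
      _ ≤ (4 / 90 ^ 8) * L ^ 12 * (ρ ^ 3 * S₃) := mul_le_mul_of_nonneg_left h3 (by positivity)
      _ = (4 / 90 ^ 8) * L ^ 12 * ρ ^ 3 * S₃ := by ring
  -- constants
  have hL12 : (239000000 : ℝ) ^ 12 ≤ L ^ 12 := pow_le_pow_left₀ (by norm_num) hL 12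
  have hc : (2000000 : ℝ) ≤ (1 / 4) * 239000000 ^ 12 := by norm_num
  have t2' : L * (2 * Jv) ≤ L * (2000000 * ρ ^ 3 * S₃) := mul_le_mul_of_nonneg_left t2 hL0
  have t3' : L * (2 * Y⁻¹ ^ 8 * W) ≤ L * ((4 / 90 ^ 8) * L ^ 12 * ρ ^ 3 * S₃) := mul_le_mul_of_nonneg_left t3 hL0
  have hX1 : 0 ≤ L ^ 13 * (ρ ^ 3 * S₃) := by positivity
  have hsum : (6 / 11520 ^ 2) * L ^ 13 * ρ ^ 3 * S₃ + L * (2000000 * ρ ^ 3 * S₃) + L * ((4 / 90 ^ 8) * L ^ 12 * ρ ^ 3 * S₃) ≤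
      ρ ^ 3 * L ^ 13 * S₃ := by
    have h2 : (2000000 : ℝ) * L ≤ (1 / 4) * L ^ 13 := by
      have h := hc.trans (by nlinarith only [hL12] : (1 / 4 : ℝ) * 239000000 ^ 12 ≤ (1 / 4) * L ^ 12)
      calc (2000000 : ℝ) * L ≤ (1 / 4) * L ^ 12 * L := mul_le_mul_of_nonneg_right h hL0
        _ = (1 / 4) * L ^ 13 := by ring
    have e : (6 / 11520 ^ 2) * L ^ 13 * ρ ^ 3 * S₃ + L * (2000000 * ρ ^ 3 * S₃) + L * ((4 / 90 ^ 8) * L ^ 12 * ρ ^ 3 * S₃) =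
        ((6 / 11520 ^ 2 + 4 / 90 ^ 8) * L ^ 13 + 2000000 * L) * (ρ ^ 3 * S₃) := by ring
    rw [e, show ρ ^ 3 * L ^ 13 * S₃ = L ^ 13 * (ρ ^ 3 * S₃) by ring]
    have hcoef : (6 / 11520 ^ 2 + 4 / 90 ^ 8) * L ^ 13 + 2000000 * L ≤ L ^ 13 := by
      have : (6 / 11520 ^ 2 + 4 / 90 ^ 8 : ℝ) * L ^ 13 ≤ (3 / 4) * L ^ 13 :=
        mul_le_mul_of_nonneg_right (by norm_num) (by positivity)
      linarith
    exact mul_le_mul_of_nonneg_right hcoef hX0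
  have e : L * ((2 * M + 2 * W) / (1280 * (9 * ρ) + 2388) ^ 2 + (2 * Jv + 2 * Y⁻¹ ^ 8 * W)) =
      L * ((2 * M + 2 * W) / (1280 * (9 * ρ) + 2388) ^ 2) + L * (2 * Jv) + L * (2 * Y⁻¹ ^ 8 * W) := by ring
  rw [e]
  linarith [t1, t2', t3', hsum]

/-- The second bracket of `Θ₁, Θ₂` (gradient currency and floor-weighted energy at `Y ≥ 90ρ`):
`ρ³ · 6(2P_Y + 2Y⁻⁸E) ≤ L¹¹ (C/ρ + Φ² + Du²/(ρ²r⁴) + ρ²N/r⁷)`. [folklore] -/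
theorem bracket_two_le {L ρ r C Du Λ Φ Ntot P E Y : ℝ} (hL : 239000000 ≤ L) (hρ : 64 ≤ ρ) (hr : 1 ≤ r) (hC : 0 ≤ C)
    (hN : 0 ≤ Ntot) (hΛ0 : 0 ≤ Λ) (hΛ1 : Λ ≤ 1)
    (hP : P ≤ L ^ 4 * (C / ρ ^ 4 + Du ^ 2 / (r ^ 4 * ρ ^ 5) + Φ ^ 2 / ρ ^ 3 + Ntot / (r ^ 7 * ρ)))
    (hE0 : 0 ≤ E) (hE : E ≤ L ^ 10 * (C / ρ ^ 2 + Λ ^ 2 * C * ρ ^ 4 + ρ ^ 5 * Φ ^ 2 + ρ ^ 2 * Du ^ 2 / r ^ 4))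
    (hY0 : 0 < Y) (hY : 90 * ρ ≤ Y) :
    ρ ^ 3 * (6 * (2 * P + 2 * Y⁻¹ ^ 8 * E)) ≤ L ^ 11 * (C / ρ + Φ ^ 2 + Du ^ 2 / (ρ ^ 2 * r ^ 4) + ρ ^ 2 * Ntot / r ^ 7) := by
  have hρ0 : 0 < ρ := by linarith
  have hρ1 : (1 : ℝ) ≤ ρ := by linarith
  have hr0 : 0 < r := by linarith
  have hL0 : 0 ≤ L := le_trans (by norm_num) hL
  have hL1 : 1 ≤ L := le_trans (by norm_num) hL
  set S' : ℝ := C / ρ + Φ ^ 2 + Du ^ 2 / (ρ ^ 2 * r ^ 4) + ρ ^ 2 * Ntot / r ^ 7 with hS'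
  have hn1 : 0 ≤ C / ρ := by positivity
  have hn2 : 0 ≤ Φ ^ 2 := by positivity
  have hn3 : 0 ≤ Du ^ 2 / (ρ ^ 2 * r ^ 4) := by positivity
  have hn4 : 0 ≤ ρ ^ 2 * Ntot / r ^ 7 := by positivity
  have hS0 : 0 ≤ S' := by positivity
  have hΛ2 : Λ ^ 2 ≤ 1 := pow_le_one₀ hΛ0 hΛ1
  -- ρ³ P ≤ L⁴ S'
  have t1 : ρ ^ 3 * P ≤ L ^ 4 * S' := by
    have e : ρ ^ 3 * (L ^ 4 * (C / ρ ^ 4 + Du ^ 2 / (r ^ 4 * ρ ^ 5) + Φ ^ 2 / ρ ^ 3 + Ntot / (r ^ 7 * ρ))) = L ^ 4 * S' := by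
      rw [hS']; field_simp; ring
    calc ρ ^ 3 * P ≤ ρ ^ 3 * (L ^ 4 * (C / ρ ^ 4 + Du ^ 2 / (r ^ 4 * ρ ^ 5) + Φ ^ 2 / ρ ^ 3 + Ntot / (r ^ 7 * ρ))) :=
          mul_le_mul_of_nonneg_left hP (by positivity)
      _ = L ^ 4 * S' := e
  -- ρ³ Y⁻⁸ E ≤ (2/90⁸) L¹⁰ S'
  have hYinv : Y⁻¹ ^ 8 ≤ (90 * ρ)⁻¹ ^ 8 := pow_le_pow_left₀ (by positivity) (inv_anti₀ (by positivity) hY) 8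
  have hSE : (C / ρ ^ 2 + Λ ^ 2 * C * ρ ^ 4 + ρ ^ 5 * Φ ^ 2 + ρ ^ 2 * Du ^ 2 / r ^ 4) / ρ ^ 5 ≤ 2 * S' := by
    have e : (C / ρ ^ 2 + Λ ^ 2 * C * ρ ^ 4 + ρ ^ 5 * Φ ^ 2 + ρ ^ 2 * Du ^ 2 / r ^ 4) / ρ ^ 5 =
        (C / ρ) / ρ ^ 6 + Λ ^ 2 * (C / ρ) + Φ ^ 2 + (Du ^ 2 / (ρ ^ 2 * r ^ 4)) / ρ := by
      field_simp
    rw [e]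
    have hρ6 : (1 : ℝ) ≤ ρ ^ 6 := one_le_pow₀ hρ1
    have h1 : (C / ρ) / ρ ^ 6 ≤ C / ρ := div_le_self hn1 hρ6
    have h2 : Λ ^ 2 * (C / ρ) ≤ C / ρ := by nlinarith only [hΛ2, hn1]
    have h3 : (Du ^ 2 / (ρ ^ 2 * r ^ 4)) / ρ ≤ Du ^ 2 / (ρ ^ 2 * r ^ 4) := div_le_self hn3 hρ1
    rw [hS']
    linarith
  have t2 : ρ ^ 3 * (Y⁻¹ ^ 8 * E) ≤ (2 / 90 ^ 8) * L ^ 10 * S' := by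
    have h1 : Y⁻¹ ^ 8 * E ≤ (90 * ρ)⁻¹ ^ 8 * (L ^ 10 * (C / ρ ^ 2 + Λ ^ 2 * C * ρ ^ 4 + ρ ^ 5 * Φ ^ 2 + ρ ^ 2 * Du ^ 2 / r ^ 4)) :=
      mul_le_mul hYinv hE hE0 (by positivity)
    have e : ρ ^ 3 * ((90 * ρ)⁻¹ ^ 8 * (L ^ 10 * (C / ρ ^ 2 + Λ ^ 2 * C * ρ ^ 4 + ρ ^ 5 * Φ ^ 2 + ρ ^ 2 * Du ^ 2 / r ^ 4))) =
        (1 / 90 ^ 8) * L ^ 10 * ((C / ρ ^ 2 + Λ ^ 2 * C * ρ ^ 4 + ρ ^ 5 * Φ ^ 2 + ρ ^ 2 * Du ^ 2 / r ^ 4) / ρ ^ 5) := by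
      field_simp
    calc ρ ^ 3 * (Y⁻¹ ^ 8 * E)
        ≤ ρ ^ 3 * ((90 * ρ)⁻¹ ^ 8 * (L ^ 10 * (C / ρ ^ 2 + Λ ^ 2 * C * ρ ^ 4 + ρ ^ 5 * Φ ^ 2 + ρ ^ 2 * Du ^ 2 / r ^ 4))) :=
          mul_le_mul_of_nonneg_left h1 (by positivity)
      _ = (1 / 90 ^ 8) * L ^ 10 * ((C / ρ ^ 2 + Λ ^ 2 * C * ρ ^ 4 + ρ ^ 5 * Φ ^ 2 + ρ ^ 2 * Du ^ 2 / r ^ 4) / ρ ^ 5) := e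
      _ ≤ (1 / 90 ^ 8) * L ^ 10 * (2 * S') := mul_le_mul_of_nonneg_left hSE (by positivity)
      _ = (2 / 90 ^ 8) * L ^ 10 * S' := by ring
  -- constants
  have hL4 : L ^ 4 ≤ L ^ 10 := pow_le_pow_right₀ hL1 (by norm_num)
  have hL10 : L ^ 10 * 239000000 ≤ L ^ 11 := by
    rw [pow_succ]; exact mul_le_mul_of_nonneg_left hL (by positivity)
  have e : ρ ^ 3 * (6 * (2 * P + 2 * Y⁻¹ ^ 8 * E)) = 12 * (ρ ^ 3 * P) + 12 * (ρ ^ 3 * (Y⁻¹ ^ 8 * E)) := by ring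
  rw [e]
  have h12 : 12 * (ρ ^ 3 * P) + 12 * (ρ ^ 3 * (Y⁻¹ ^ 8 * E)) ≤ (12 * L ^ 4 + 12 * ((2 / 90 ^ 8) * L ^ 10)) * S' := by
    nlinarith only [t1, t2]
  have hcoef : 12 * L ^ 4 + 12 * ((2 / 90 ^ 8) * L ^ 10) ≤ L ^ 11 := by nlinarith only [hL4, hL10, pow_nonneg hL0 10]
  exact h12.trans (mul_le_mul_of_nonneg_right hcoef hS0)

end Summit.AtomisticToContinuum.Crystallization.Theorems.ExcessDecayLiouville

end
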